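import Mathlib
import Literature.NumberTheory.Transcendental.MZVSimplexRep

/-!
# `TateLifting` (stmt-KontsevichZagierPeriods-9129), line `Sketch` — stub `stub_simplexHull`

SIMPLEX = INTERIOR OF THE CONVEX HULL. For an affinely independent family `v₀, …, v_n` of points of
`ℝⁿ` the affine map `p(x) = v₀ + Σ_j x_j (v_{j+1} − v_j) = A x + v₀`, `A_{ij} = v_{j+1,i} − v_{j,i}`
(the matrix of consecutive differences), writes `p(x)` as the affine combination of the `v_k` with
barycentric weights `λ_k = x_{k−1} − x_k` (conventions `x_{−1} = 1`, `x_n = 0`; in Lean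
`λ = Fin.cons 1 x − Fin.snoc x 0`, `SimplexHull.mulVec_add_eq_affineCombination`). The `v_k` form an
affine basis of `ℝⁿ` (`n + 1` affinely independent points of an `n`-dimensional space), so the
barycentric coordinates of `p(x)` ARE the `λ_k`; all of them are positive iff
`1 > x₀ > x₁ > ⋯ > x_{n−1} > 0`, i.e. iff `x` lies in the open ordered simplex
`KZ.openOrderedSimplex n` (`SimplexHull.snoc_lt_cons_iff`). Consequences: `A x = 0` forces
`λ = (1, 0, …, 0)`, whence `x = 0` by downward induction (`SimplexHull.eq_zero_of_eq_snoc_succ`), so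
`det A ≠ 0` (`Matrix.exists_mulVec_eq_zero_iff`); and by `AffineBasis.interior_convexHull` the
interior of the convex hull of the `v_k` (the points all of whose barycentric coordinates are
positive) is exactly `p '' KZ.openOrderedSimplex n`, `p` being onto (`A` is invertible).

References: folklore (barycentric coordinates of a simplex); M. Kontsevich, D. Zagier, *Periods*
(2001), §1.1 for the ordered simplex `{1 > t₁ > ⋯ > t_n > 0}`.
-/

noncomputable section

open Set
open Literature.NumberTheory.Transcendental

namespace Summit.KontsevichZagierPeriods.InverseLandau

namespace SimplexHull

/-- The weights `λ = Fin.cons 1 x − Fin.snoc x 0`, i.e. `λ_k = x_{k−1} − x_k` with `x_{−1} = 1`,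
`x_n = 0`, sum to `1` (the sum telescopes). [folklore] -/
theorem sum_cons_sub_snoc {n : ℕ} (x : Fin n → ℝ) :
    ∑ k, ((Fin.cons 1 x : Fin (n + 1) → ℝ) - (Fin.snoc x 0 : Fin (n + 1) → ℝ)) k = 1 := by
  simp only [Pi.sub_apply, Finset.sum_sub_distrib, Fin.sum_cons, Fin.sum_snoc, add_zero,
    add_sub_cancel_right]

/-- `A x + v₀ = Σ_k λ_k v_k` with `λ = Fin.cons 1 x − Fin.snoc x 0`: the affine map attached to the
matrix of consecutive differences is the affine combination with the telescoped weights. [folklore] -/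
theorem mulVec_add_eq_affineCombination {n : ℕ} (v : Fin (n + 1) → (Fin n → ℝ)) (x : Fin n → ℝ) :
    (Matrix.of fun i j : Fin n => v j.succ i - v (Fin.castSucc j) i).mulVec x + v 0 =
      Finset.univ.affineCombination ℝ v
        ((Fin.cons 1 x : Fin (n + 1) → ℝ) - (Fin.snoc x 0 : Fin (n + 1) → ℝ)) := by
  rw [Finset.univ.affineCombination_eq_linear_combination _ _ (sum_cons_sub_snoc x)]
  simp only [Pi.sub_apply, sub_smul, Finset.sum_sub_distrib]
  rw [Fin.sum_univ_succ, Fin.sum_univ_castSucc]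
  simp only [Fin.cons_zero, Fin.cons_succ, Fin.snoc_castSucc, Fin.snoc_last, one_smul, zero_smul,
    add_zero]
  ext i
  have hx : ∀ j : Fin n, (v j.succ i - v (Fin.castSucc j) i) * x j =
      x j * v j.succ i - x j * v (Fin.castSucc j) i := fun j => by ring
  simp only [Pi.add_apply, Pi.sub_apply, Finset.sum_apply, Pi.smul_apply, smul_eq_mul,
    Matrix.mulVec, dotProduct, Matrix.of_apply, hx, Finset.sum_sub_distrib]
  ring

/-- Downward induction: if `x_j = x_{j+1}` for all `j` (with `x_n = 0`), then `x = 0`. [folklore] -/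
theorem eq_zero_of_eq_snoc_succ {n : ℕ} (x : Fin n → ℝ)
    (h : ∀ j : Fin n, x j = (Fin.snoc x 0 : Fin (n + 1) → ℝ) j.succ) : x = 0 := by
  cases n with
  | zero => exact funext fun j => j.elim0
  | succ m =>
    funext j
    induction j using Fin.reverseInduction with
    | last =>
      rw [h, Fin.succ_last, Fin.snoc_last]
      rfl
    | cast j ih =>
      rw [h, Fin.succ_castSucc, Fin.snoc_castSucc, ih]
      rfl

/-- The weights `λ_k = x_{k−1} − x_k` (`x_{−1} = 1`, `x_n = 0`) are all positive iff
`1 > x₀ > x₁ > ⋯ > x_{n−1} > 0`, i.e. iff `x` lies in the open ordered simplex. [folklore] -/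
theorem snoc_lt_cons_iff {n : ℕ} (x : Fin n → ℝ) :
    (∀ k : Fin (n + 1), (Fin.snoc x 0 : Fin (n + 1) → ℝ) k < (Fin.cons 1 x : Fin (n + 1) → ℝ) k) ↔
      x ∈ KZ.openOrderedSimplex n := by
  simp only [KZ.openOrderedSimplex, mem_setOf_eq]
  cases n with
  | zero =>
    refine ⟨fun _ => ⟨fun i => i.elim0, fun i => i.elim0, Subsingleton.strictAnti x⟩, fun _ k => ?_⟩
    cases k using Fin.cases with
    | zero =>
      rw [Fin.cons_zero, Fin.snoc_zero]
      exact one_pos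
    | succ i => exact i.elim0
  | succ m =>
    constructor
    · intro h
      have hanti : StrictAnti x := by
        rw [Fin.strictAnti_iff_succ_lt]
        intro i
        have hi := h i.castSucc.succ
        rw [Fin.cons_succ] at hi
        rwa [Fin.succ_castSucc, Fin.snoc_castSucc] at hi
      have h0 := h (Fin.last m).succ
      rw [Fin.cons_succ, Fin.succ_last, Fin.snoc_last] at h0
      have h1 := h (0 : Fin (m + 1)).castSucc
      rw [Fin.snoc_castSucc, Fin.castSucc_zero', Fin.cons_zero] at h1
      exact ⟨fun i => h0.trans_le (hanti.antitone (Fin.le_last i)),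
        fun i => (hanti.antitone (Fin.zero_le i)).trans_lt h1, hanti⟩
    · rintro ⟨hpos, hlt, hanti⟩ k
      cases k using Fin.cases with
      | zero =>
        change (Fin.snoc x 0 : Fin (m + 2) → ℝ) (Fin.castSucc (0 : Fin (m + 1))) <
          (Fin.cons 1 x : Fin (m + 2) → ℝ) 0
        rw [Fin.cons_zero, Fin.snoc_castSucc]
        exact hlt 0
      | succ j =>
        rw [Fin.cons_succ]
        cases j using Fin.lastCases with
        | last =>
          rw [Fin.succ_last, Fin.snoc_last]
          exact hpos _
        | cast i =>
          rw [Fin.succ_castSucc, Fin.snoc_castSucc]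
          exact hanti i.castSucc_lt_succ

end SimplexHull

/-- **Simplex = interior of the convex hull** (stub `stub_simplexHull` of the lead's skeleton, the
body of `SimplexHull`): for an affinely independent family `v₀, …, v_n` in `ℝⁿ`, the matrix `A` of
consecutive differences `A_{ij} = v_{j+1,i} − v_{j,i}` is invertible and the interior of the convex
hull of the `v_k` is the image of the open ordered simplex `{1 > x₀ > ⋯ > x_{n−1} > 0}` under
`x ↦ A x + v₀`. Proof: the `v_k` form an affine basis of `ℝⁿ`; the barycentric coordinates of
`A x + v₀` are `λ_k = x_{k−1} − x_k` (`x_{−1} = 1`, `x_n = 0`), all positive iff `x` is in the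
ordered simplex (`AffineBasis.interior_convexHull`); `A x = 0` forces `x = 0`. [folklore] -/
theorem tateLifting_simplexHull :
    ∀ (n : ℕ) (v : Fin (n + 1) → (Fin n → ℝ)), AffineIndependent ℝ v →
      (Matrix.of fun i j : Fin n => v j.succ i - v (Fin.castSucc j) i).det ≠ 0 ∧
      interior (convexHull ℝ (Set.range v)) =
        (fun x => (Matrix.of fun i j : Fin n => v j.succ i - v (Fin.castSucc j) i).mulVec x + v 0) ''
          KZ.openOrderedSimplex n := by
  intro n v hv
  have htot : affineSpan ℝ (Set.range v) = ⊤ := by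
    rw [hv.affineSpan_eq_top_iff_card_eq_finrank_add_one, Fintype.card_fin, Module.finrank_fin_fun]
  set b : AffineBasis (Fin (n + 1)) ℝ (Fin n → ℝ) := ⟨v, hv, htot⟩
  set A : Matrix (Fin n) (Fin n) ℝ := Matrix.of fun i j : Fin n => v j.succ i - v (Fin.castSucc j) i
    with hA
  -- the barycentric coordinates of `A x + v 0` are the telescoped weights
  have hcoord : ∀ (x : Fin n → ℝ) (k : Fin (n + 1)), b.coord k (A.mulVec x + v 0) =
      ((Fin.cons 1 x : Fin (n + 1) → ℝ) - (Fin.snoc x 0 : Fin (n + 1) → ℝ)) k := by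
    intro x k
    rw [hA, SimplexHull.mulVec_add_eq_affineCombination v x]
    exact b.coord_apply_combination_of_mem (Finset.mem_univ k) (SimplexHull.sum_cons_sub_snoc x)
  -- the kernel of `A` is trivial, so `det A ≠ 0`
  have hker : ∀ x : Fin n → ℝ, A.mulVec x = 0 → x = 0 := by
    intro x hx
    refine SimplexHull.eq_zero_of_eq_snoc_succ x fun j => ?_
    have h1 := hcoord x j.succ
    rw [hx, zero_add, show v 0 = b 0 from rfl, b.coord_apply_ne (Fin.succ_ne_zero j),
      Pi.sub_apply, Fin.cons_succ] at h1
    linarith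
  have hdet : A.det ≠ 0 := by
    intro h
    obtain ⟨x, hx, hAx⟩ := Matrix.exists_mulVec_eq_zero_iff.mpr h
    exact hx (hker x hAx)
  refine ⟨hdet, ?_⟩
  -- interior of the hull = all barycentric coordinates positive
  have hint : interior (convexHull ℝ (Set.range v)) = {y | ∀ i, 0 < b.coord i y} :=
    b.interior_convexHull
  rw [hint]
  ext y
  constructor
  · intro hy
    rw [mem_setOf_eq] at hy
    have hAy : A.mulVec (A⁻¹.mulVec (y - v 0)) + v 0 = y := by
      rw [Matrix.mulVec_mulVec, Matrix.mul_nonsing_inv A (Ne.isUnit hdet), Matrix.one_mulVec,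
        sub_add_cancel]
    refine ⟨A⁻¹.mulVec (y - v 0), ?_, hAy⟩
    rw [← SimplexHull.snoc_lt_cons_iff]
    intro k
    have hk := hy k
    rw [← hAy, hcoord, Pi.sub_apply, sub_pos] at hk
    exact hk
  · rintro ⟨x, hx, rfl⟩ k
    change 0 < b.coord k (A.mulVec x + v 0)
    rw [hcoord, Pi.sub_apply, sub_pos]
    exact (SimplexHull.snoc_lt_cons_iff x).mpr hx k

end Summit.KontsevichZagierPeriods.InverseLandau

end
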